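import Summits.QuantumFields.BalabanUV.T4Continuum.Support.ShellMeasureMinimiserDecayAccretive
import Summits.QuantumFields.BalabanUV.Beta.AccretiveCombesThomasSandwichSite
import Summits.QuantumFields.BalabanUV.Beta.MultiscaleDistanceMetric

/-!
# `T4Continuum.ShellMeasureMinimiserDecaySite` — ROW S123 = J8 file 3 «J8 ALONG SITE WEIGHTS»: the sandwiched inverse `(QA⁻¹Q*)⁻¹`
# and the minimiser `H = A⁻¹Q*(QA⁻¹Q*)⁻¹` have the E6 row shape under the conjugated coercivity of `A` along ONE SITE WEIGHT PER
# TARGET BLOCK with thresholds (the shape the MODEL operator supplies), and the MODEL half-instance on `cmat levelOp` —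
# repair-on-finding F-ne7cleaf07g12-1 of files 1∕2
(cell `pub-balaban`, sub-cell `t4`, spine estimate NE7c (node U5b); NE7c ROUND-2 crew `t4-ne7c-formalise-*`, unit
`b2b-balaban-t4-ne7c-formalise-leaf-07` gen 12; owner table `t4/b2b-balaban-t4-ne7c-p1/LEAVES-NE7c-P1.md` row S123 (R-ne7cp1-g37-12);
FINDING F-ne7cleaf07g12-1 (journal `CLAIMS.log`); ADDITIVE — imports file 2 `ShellMeasureMinimiserDecayAccretive` (hence file 1),
beta-d4-p3's K4 `Beta/AccretiveCombesThomasSandwichSite` (⊇ an4's `MultiscaleCombesThomas`, beta-d4-p2's `MultiscaleDecay`) and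
beta-d4-p2's `Beta/MultiscaleDistanceMetric` ONLY, everything BY NAME; touches NO host; [folklore] finite-dimensional linear algebra;
0 `def`, 0 `def … : Prop`, 0 sorry, 0 citation tags.)

HONEST FRAMING.  Finite four-torus programme, rung (B)+1 only — NOT infinite volume, NOT a mass gap, NOT the Clay problem, NOT summit
progress.  NE7c (`T4IndicatorShell.ShellWeightBound`) is NOT PRINTED in [Balaban 1983–89] and NOT PROVED; «NE7c ⇐ the named binders»
(trigger c3).  Nothing of Bałaban's is asserted, cited or discharged here; no census row of THE ONE CALL moves (S123 never moved one).
HONEST DEPENDENCY (cell): continuum YM on T⁴ ⇐ BetaPertH ∧ nine spine estimates (0/9 proved); BetaPertH ⇐ (D1) ∧ (D4) ∧ CAP+tail;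
G-an2-4 gates asym, D1 and NE2/3/4.

WHY THIS FILE (F-ne7cleaf07g12-1).  Files 1∕2 of S123 carry, in every decay END, the conjugated-coercivity binder
`hc : ∀ y′ z, m·‖z‖² ≤ Re conjForm A κ (fun x ↦ D (blk x) y′) z` along BLOCK-CONSTANT weights (the shape of the K3-level
`AccretiveCombesThomasSandwich.norm_sandwich_inv_le`).  For a FINE operator of [B9] (3.24) SHAPE (the J-lane's MODEL `levelOp`, local
coercivity profile `μ₀·n(x)⁻²`, `MultiscaleDecay.hc_levelOp`) that binder is NOT suppliable at level-free rates: a cell-constant weight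
jumps by `≍ 1` across ONE face bond where `MultiscaleDecayBudget.bond_budget_le` budgets `κ·n⁻¹` per bond (β certificate C-d4p3-31
INFO-2), and §5's exact two-site lemma shows no source can do better (`κ·D ≤ arcosh(1 + γ∕c²)` for a bond of weight `c`, local gap `γ`).
K4 `AccretiveCombesThomasSandwichSite` has the admissible shape — ONE weight `ρ_{y′}` per TARGET block with THRESHOLDS `ρ_{y′} ≤ δ` on
block `y′`, `ρ_{y′} ≥ D(y,y′) − δ` on block `y`, a block-constant profile `ν` with a floor `ν₀` — and its §6 INSTANTIATES it on `cmat levelOp`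
(`localConjCoercive_cmat_levelOp`, `sdist_corner_thresholds`, `δ = 2d`).  This file re-runs file 1's chain in that currency:
* §1 `norm_sandwich_apply_le_site` (:= K4 `norm_sandwich_inv_le_siteFloor`) and **`norm_sandwich_inv_apply_le_site`**: with the sandwich's
  `Re`-coercivity `c_S` DISPLAYED (file 1's `sandwich_reCoercive`, file 2's `sandwich_reCoercive_of_accretive`, an4's
  `CoarseCoerciveQuasiReconstruction.sandwich_coercive_of_quasiReconstruction` all supply it) and `θ := (N∕ν₀)e^{2κδ}`, file 1 §1 gives
  `‖(QA⁻¹Q*)⁻¹(y,y′)‖ ≤ e^{−κ₁D(y,y′)}∕(c_S − κ₁θL₁)` — [B9] (3.132) ∕ [B5] (1.100)–(1.102) TYPE (locators, not citations);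
* §2 **`norm_inv_mulVec_test_le_site`**: `‖(A⁻¹q_{y′})(x)‖ ≤ (√N∕ν₀)e^{2κδ}e^{−κD(blk x, y′)}` (an4's `combesThomas_local`, `u = e_x`);
* §3 ENDs **`norm_minimiser_apply_le_site`** `‖H(x,y)‖ ≤ (√N·e^{2κδ}·L∕(ν₀(c_S − κ₁θL₁)))·e^{−κ₁D(blk x, y)}` — LITERALLY the hosts' E6 row
  shape `‖k c b′‖ ≤ c·e^{−δ·dis (pos c) (pos′ b′)}` — and **`norm_minimiser_mulVec_le_site`** ((46)-shape sup bound); `Q·H = 1` is file 2's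
  `Qm_mul_minimiser_of_reCoercive` verbatim;
* §4 THE MODEL HALF-INSTANCE (K4 §6's setting verbatim): `A = cmat levelOp` on a pairwise-disjoint covering cube family, `blk = cellOf`,
  `D = d_n` on the cell corners, `ρ_{k′} = d_n(·, t_{k′})`, `δ = 2d`, `ν_k = μ₀S_{l_k}⁻²`, floor `μ₀S_max⁻²`: **`norm_cellSandwichInv_levelOp_le`**,
  **`norm_minimiser_levelOp_apply_le`** — E6 rows along `d_n` with constants from `d, c_max, a_max, C, κ, κ₁, S_max, Nq, c_S, L₁, L` ONLY,
  modulo the ONE displayed coarse-coercivity datum `c_S` (row D4's interface item (I3); `CoarseCoerciveCovariantEnergy` NOT wired here);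
* §5 rule G-1 (the one-site toy inhabits §3) and the NEGATIVE two-site lemma **`blockConstant_conjCoercive_le`** documenting the finding.
NOT HERE: node O's identification (WHICH `A`, `q`, reconstruction Bałaban's sectioned scheme produces; (80)–(81)'s curvature terms,
the `D*RD` term, the vector layer), the S124-type E7 instance on S117's slot family, the energy datum `c_S` — later files.
-/

noncomputable section

open Finset Matrix
open scoped Matrix ComplexConjugate BigOperators

namespace Summit.QuantumFields.BalabanUV.T4Continuum.ShellMeasureMinimiserDecaySite

open Summit.QuantumFields.BalabanUV.Beta.AccretiveCombesThomas Summit.QuantumFields.BalabanUV.Beta.AccretiveCombesThomasSandwichSite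
open Summit.QuantumFields.BalabanUV.Beta.AccretiveCombesThomasSandwich (sandwich)
open Summit.QuantumFields.BalabanUV.Beta.AccretiveCombesThomasSandwichLocal (sum_inv_mul_norm_sq_eq)
open Summit.QuantumFields.BalabanUV.Beta.MultiscaleCombesThomas (combesThomas_local isUnit_of_localConjCoercive)
open Summit.QuantumFields.BalabanUV.Beta.UnitLatticeResolventWalk (Qm superpose)
open Summit.QuantumFields.BalabanUV.Beta.PropagatorWoodburyFibre (minimiser)
open Summit.QuantumFields.BalabanUV.T4Continuum.ShellMeasureMinimiserDecay
  (norm_inv_apply_le_of_reCoercive_decay minimiser_eq inv_mul_conjTranspose_apply re_conjForm_one)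
open Summit.QuantumFields.BalabanUV.T4Continuum.ShellMeasureMinimiserDecayAccretive (sandwich_reCoercive_of_accretive)
open Literature.MathematicalPhysics.QuantumFieldTheory.Balaban1983to89.B5Prop11Lower (nsq nsq_nonneg star_dotProduct_self)

variable {X Y : Type*} [Fintype X] [DecidableEq X] [Fintype Y] [DecidableEq Y]

/-! ## §1 The sandwich and its inverse along SITE weights with thresholds -/

omit [Fintype Y] [DecidableEq Y] in
/-- Entry form of K4 `norm_sandwich_inv_le_siteFloor`: one weight `ρ_{y′}` per target block with thresholds `δ`, block-constant profile
`ν ≥ ν₀ > 0`, block-supported tests `‖q_y‖² ≤ N` ⟹ `‖(QA⁻¹Q*)(y,y′)‖ ≤ (N∕ν₀)·e^{2κδ}·e^{−κD(y,y′)}`. [folklore] -/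
theorem norm_sandwich_apply_le_site (A : Matrix X X ℂ) (blk : X → Y) (D : Y → Y → ℝ) (ρ : Y → X → ℝ) (δ : ℝ)
    (hρ0 : ∀ y' x, blk x = y' → ρ y' x ≤ δ) (hρD : ∀ y y' x, blk x = y → D y y' - δ ≤ ρ y' x)
    (q : Y → X → ℂ) (hq : ∀ y x, blk x ≠ y → q y x = 0) {N : ℝ} (hN : ∀ y, nsq (q y) ≤ N)
    {κ ν₀ : ℝ} {ν : Y → ℝ} (hκ : 0 ≤ κ) (hν0 : 0 < ν₀) (hfl : ∀ y, ν₀ ≤ ν y)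
    (hc : ∀ y', ∀ z : X → ℂ, ∑ x, ν (blk x) * ‖z x‖ ^ 2 ≤ (conjForm A κ (ρ y') z).re) (y y' : Y) :
    ‖sandwich A q y y'‖ ≤ N / ν₀ * Real.exp (2 * κ * δ) * Real.exp (-(κ * D y y')) :=
  calc ‖sandwich A q y y'‖ = ‖star (q y) ⬝ᵥ (A⁻¹ *ᵥ q y')‖ := rfl
    _ ≤ _ := norm_sandwich_inv_le_siteFloor A blk D ρ δ hρ0 hρD q hq hN hκ hν0 hfl hc y y'

/-- **THE SANDWICHED INVERSE IS EXPONENTIALLY LOCALISED, site-weight form** ([B9] (3.132) ∕ [B5] (1.100)–(1.102) TYPE for abstract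
data; locators): `D` a symmetric pseudo-metric on the unit index set, the sandwich `Re`-coercive with `c_S` (DISPLAYED), first-moment
profile `L₁`, `θ := (N∕ν₀)e^{2κδ}`, `κ₁θL₁ < c_S` ⟹ `‖(QA⁻¹Q*)⁻¹(y,y′)‖ ≤ e^{−κ₁D(y,y′)}∕(c_S − κ₁θL₁)`. [folklore] -/
theorem norm_sandwich_inv_apply_le_site (A : Matrix X X ℂ) (blk : X → Y) (D : Y → Y → ℝ) (hD0 : ∀ y, D y y = 0)
    (hDtri : ∀ i j k, D i k ≤ D i j + D j k) (hDs : ∀ i j, D i j = D j i) (ρ : Y → X → ℝ) (δ : ℝ)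
    (hρ0 : ∀ y' x, blk x = y' → ρ y' x ≤ δ) (hρD : ∀ y y' x, blk x = y → D y y' - δ ≤ ρ y' x)
    (q : Y → X → ℂ) (hq : ∀ y x, blk x ≠ y → q y x = 0) {N : ℝ} (hN0 : 0 ≤ N) (hN : ∀ y, nsq (q y) ≤ N)
    {κ ν₀ : ℝ} {ν : Y → ℝ} (hκ : 0 ≤ κ) (hν0 : 0 < ν₀) (hfl : ∀ y, ν₀ ≤ ν y)
    (hc : ∀ y', ∀ z : X → ℂ, ∑ x, ν (blk x) * ‖z x‖ ^ 2 ≤ (conjForm A κ (ρ y') z).re)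
    {cS : ℝ} (hcS : ∀ B : Y → ℂ, cS * nsq B ≤ (star B ⬝ᵥ (sandwich A q *ᵥ B)).re)
    {κ₁ L₁ : ℝ} (hκ₁ : 0 ≤ κ₁) (hL₁ : ∀ y, ∑ y', D y y' * Real.exp (-((κ - κ₁) * D y y')) ≤ L₁)
    (hsmall : κ₁ * (N / ν₀ * Real.exp (2 * κ * δ)) * L₁ < cS) (y y' : Y) :
    ‖(sandwich A q)⁻¹ y y'‖ ≤ Real.exp (-(κ₁ * D y y')) / (cS - κ₁ * (N / ν₀ * Real.exp (2 * κ * δ)) * L₁) :=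
  norm_inv_apply_le_of_reCoercive_decay (sandwich A q) D hD0 hDtri hDs hκ₁
    (mul_nonneg (div_nonneg hN0 hν0.le) (Real.exp_pos _).le) hcS
    (norm_sandwich_apply_le_site A blk D ρ δ hρ0 hρD q hq hN hκ hν0 hfl hc) hL₁ hsmall y y'

/-! ## §2 The one-site pairing along site weights -/

omit [Fintype Y] [DecidableEq Y] in
/-- **One-site pairing, site-weight form**: `‖(A⁻¹q_{y′})(x)‖ ≤ (√N∕ν₀)·e^{2κδ}·e^{−κD(blk x, y′)}` (an4's `combesThomas_local`, `u = e_x`,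
`v = q_{y′}` supported in block `y′`, along the shifted weight `ρ_{y′} − δ`: `≤ 0` on block `y′`, `≥ D(blk x, y′) − 2δ` at `x`). [folklore] -/
theorem norm_inv_mulVec_test_le_site (A : Matrix X X ℂ) (blk : X → Y) (D : Y → Y → ℝ) (ρ : Y → X → ℝ) (δ : ℝ)
    (hρ0 : ∀ y' x, blk x = y' → ρ y' x ≤ δ) (hρD : ∀ y y' x, blk x = y → D y y' - δ ≤ ρ y' x)
    (q : Y → X → ℂ) (hq : ∀ y x, blk x ≠ y → q y x = 0) {N : ℝ} (hN : ∀ y, nsq (q y) ≤ N)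
    {κ ν₀ : ℝ} {ν : Y → ℝ} (hκ : 0 ≤ κ) (hν0 : 0 < ν₀) (hfl : ∀ y, ν₀ ≤ ν y)
    (hc : ∀ y', ∀ z : X → ℂ, ∑ x, ν (blk x) * ‖z x‖ ^ 2 ≤ (conjForm A κ (ρ y') z).re) (x : X) (y' : Y) :
    ‖(A⁻¹ *ᵥ q y') x‖ ≤ Real.sqrt N / ν₀ * Real.exp (2 * κ * δ) * Real.exp (-(κ * D (blk x) y')) := by
  have hν : ∀ y, 0 < ν y := fun y => hν0.trans_le (hfl y)
  have hμ : ∀ e : X, 0 < ν (blk e) := fun e => hν (blk e)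
  have hAu : IsUnit A := isUnit_of_localConjCoercive hμ (hc y')
  have hdet : IsUnit A.det := (Matrix.isUnit_iff_isUnit_det A).mp hAu
  have hx : A *ᵥ (A⁻¹ *ᵥ q y') = q y' := by
    rw [Matrix.mulVec_mulVec, Matrix.mul_nonsing_inv A hdet, Matrix.one_mulVec]
  have hc' : ∀ z : X → ℂ, ∑ e, ν (blk e) * ‖z e‖ ^ 2 ≤ (conjForm A κ (fun e => ρ y' e - δ) z).re := fun z => by
    rw [conjForm_sub_const]; exact hc y' z
  have h := combesThomas_local (fun e => ρ y' e - δ) hμ hκ hc' (R := D (blk x) y' - 2 * δ) (u := Pi.single x 1) hx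
    (fun e he => by
      by_cases hex : e = x
      · subst hex; have h1 := hρD (blk e) y' e rfl; show D (blk e) y' - 2 * δ ≤ ρ y' e - δ; linarith
      · exact absurd (by simp [hex]) he)
    (fun e he => by
      by_cases hb : blk e = y'
      · have h1 := hρ0 y' e hb; show ρ y' e - δ ≤ 0; linarith
      · exact absurd (hq y' e hb) he)
  have hentry : star (Pi.single x (1 : ℂ)) ⬝ᵥ (A⁻¹ *ᵥ q y') = (A⁻¹ *ᵥ q y') x := by
    rw [dotProduct, Finset.sum_eq_single x (fun e _ he => by simp [he]) (fun h => absurd (Finset.mem_univ x) h)]; simp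
  have hu : ∑ e, (ν (blk e))⁻¹ * ‖(Pi.single x (1 : ℂ) : X → ℂ) e‖ ^ 2 = (ν (blk x))⁻¹ := by
    rw [Finset.sum_eq_single x (fun e _ he => by simp [he]) (fun h => absurd (Finset.mem_univ x) h)]; simp
  have hv : ∑ e, (ν (blk e))⁻¹ * ‖q y' e‖ ^ 2 = (ν y')⁻¹ * nsq (q y') := sum_inv_mul_norm_sq_eq blk ν q hq y'
  rw [hentry, hu, hv] at h
  have hprod : Real.sqrt ((ν (blk x))⁻¹) * Real.sqrt ((ν y')⁻¹ * nsq (q y')) ≤ Real.sqrt N / ν₀ := by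
    rw [← Real.sqrt_mul (inv_nonneg.mpr (hμ x).le)]
    have hle : (ν (blk x))⁻¹ * ((ν y')⁻¹ * nsq (q y')) ≤ N / ν₀ ^ 2 := by
      have h1 : (ν (blk x))⁻¹ ≤ ν₀⁻¹ := inv_anti₀ hν0 (hfl (blk x))
      have h2 : (ν y')⁻¹ ≤ ν₀⁻¹ := inv_anti₀ hν0 (hfl y')
      calc (ν (blk x))⁻¹ * ((ν y')⁻¹ * nsq (q y')) ≤ ν₀⁻¹ * (ν₀⁻¹ * N) :=
            mul_le_mul h1 (mul_le_mul h2 (hN y') (nsq_nonneg _) (inv_nonneg.mpr hν0.le))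
              (mul_nonneg (inv_nonneg.mpr (hν y').le) (nsq_nonneg _)) (inv_nonneg.mpr hν0.le)
        _ = N / ν₀ ^ 2 := by field_simp
    calc Real.sqrt ((ν (blk x))⁻¹ * ((ν y')⁻¹ * nsq (q y'))) ≤ Real.sqrt (N / ν₀ ^ 2) := Real.sqrt_le_sqrt hle
      _ = Real.sqrt N / ν₀ := by rw [Real.sqrt_div' N (sq_nonneg ν₀), Real.sqrt_sq hν0.le]
  have hexp : Real.exp (-(κ * (D (blk x) y' - 2 * δ))) = Real.exp (2 * κ * δ) * Real.exp (-(κ * D (blk x) y')) := by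
    rw [← Real.exp_add]; ring_nf
  calc ‖(A⁻¹ *ᵥ q y') x‖
      ≤ Real.exp (-(κ * (D (blk x) y' - 2 * δ))) *
          (Real.sqrt ((ν (blk x))⁻¹) * Real.sqrt ((ν y')⁻¹ * nsq (q y'))) := h
    _ ≤ Real.exp (-(κ * (D (blk x) y' - 2 * δ))) * (Real.sqrt N / ν₀) :=
        mul_le_mul_of_nonneg_left hprod (Real.exp_pos _).le
    _ = Real.sqrt N / ν₀ * Real.exp (2 * κ * δ) * Real.exp (-(κ * D (blk x) y')) := by rw [hexp]; ring

/-! ## §3 The minimiser `H = A⁻¹Q*(QA⁻¹Q*)⁻¹` along site weights -/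

/-- **THE MINIMISER's E6 ROW, site-weight form** (the hosts' shape `‖k c b′‖ ≤ c·e^{−δ·dis (pos c) (pos′ b′)}` with `𝔖 := Y`,
`pos := blk`, `pos′ := id`, `dis := D`): under §1's hypotheses and the profile `Σ_{y′} e^{−(κ−κ₁)D(y₀,y′)} ≤ L`,
`‖H(x,y)‖ ≤ (√N·e^{2κδ}·L ∕ (ν₀·(c_S − κ₁θL₁))) · e^{−κ₁·D(blk x, y)}` for ALL `x, y` (`θ = (N∕ν₀)e^{2κδ}`). [folklore] -/
theorem norm_minimiser_apply_le_site (A : Matrix X X ℂ) (blk : X → Y) (D : Y → Y → ℝ) (hD0 : ∀ y, D y y = 0)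
    (hDtri : ∀ i j k, D i k ≤ D i j + D j k) (hDs : ∀ i j, D i j = D j i) (ρ : Y → X → ℝ) (δ : ℝ)
    (hρ0 : ∀ y' x, blk x = y' → ρ y' x ≤ δ) (hρD : ∀ y y' x, blk x = y → D y y' - δ ≤ ρ y' x)
    (q : Y → X → ℂ) (hq : ∀ y x, blk x ≠ y → q y x = 0) {N : ℝ} (hN0 : 0 ≤ N) (hN : ∀ y, nsq (q y) ≤ N)
    {κ ν₀ : ℝ} {ν : Y → ℝ} (hκ : 0 ≤ κ) (hν0 : 0 < ν₀) (hfl : ∀ y, ν₀ ≤ ν y)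
    (hc : ∀ y', ∀ z : X → ℂ, ∑ x, ν (blk x) * ‖z x‖ ^ 2 ≤ (conjForm A κ (ρ y') z).re)
    {cS : ℝ} (hcS : ∀ B : Y → ℂ, cS * nsq B ≤ (star B ⬝ᵥ (sandwich A q *ᵥ B)).re)
    {κ₁ L₁ L : ℝ} (hκ₁ : 0 ≤ κ₁) (hL₁ : ∀ y, ∑ y', D y y' * Real.exp (-((κ - κ₁) * D y y')) ≤ L₁)
    (hsmall : κ₁ * (N / ν₀ * Real.exp (2 * κ * δ)) * L₁ < cS)
    (hL : ∀ y₀, ∑ y', Real.exp (-((κ - κ₁) * D y₀ y')) ≤ L) (x : X) (y : Y) :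
    ‖minimiser A (Qm q) x y‖ ≤ Real.sqrt N / ν₀ * Real.exp (2 * κ * δ) * L /
        (cS - κ₁ * (N / ν₀ * Real.exp (2 * κ * δ)) * L₁) * Real.exp (-(κ₁ * D (blk x) y)) := by
  set c' : ℝ := cS - κ₁ * (N / ν₀ * Real.exp (2 * κ * δ)) * L₁ with hc'
  set T₀ : ℝ := Real.sqrt N / ν₀ * Real.exp (2 * κ * δ) with hT₀
  have hc'0 : 0 < c' := by rw [hc']; linarith
  have hS := norm_sandwich_inv_apply_le_site A blk D hD0 hDtri hDs ρ δ hρ0 hρD q hq hN0 hN hκ hν0 hfl hc hcS hκ₁ hL₁ hsmall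
  have hT := norm_inv_mulVec_test_le_site A blk D ρ δ hρ0 hρD q hq hN hκ hν0 hfl hc x
  rw [minimiser_eq, Matrix.mul_apply]
  have hterm : ∀ y', ‖(A⁻¹ * (Qm q)ᴴ) x y' * (sandwich A q)⁻¹ y' y‖
      ≤ T₀ / c' * Real.exp (-(κ₁ * D (blk x) y)) * Real.exp (-((κ - κ₁) * D (blk x) y')) := by
    intro y'
    rw [norm_mul, inv_mul_conjTranspose_apply]
    have h1 : ‖(A⁻¹ *ᵥ q y') x‖ ≤ T₀ * Real.exp (-(κ * D (blk x) y')) := hT y'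
    have htri : Real.exp (-(κ * D (blk x) y')) * Real.exp (-(κ₁ * D y' y))
        ≤ Real.exp (-(κ₁ * D (blk x) y)) * Real.exp (-((κ - κ₁) * D (blk x) y')) := by
      rw [← Real.exp_add, ← Real.exp_add]
      refine Real.exp_le_exp.2 ?_
      have h3 := hDtri (blk x) y' y
      have h4 : 0 ≤ D (blk x) y' := by have := hDtri (blk x) y' (blk x); rw [hD0, hDs y' (blk x)] at this; linarith
      nlinarith
    calc ‖(A⁻¹ *ᵥ q y') x‖ * ‖(sandwich A q)⁻¹ y' y‖
        ≤ (T₀ * Real.exp (-(κ * D (blk x) y'))) * (Real.exp (-(κ₁ * D y' y)) / c') :=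
          mul_le_mul h1 (hS y' y) (norm_nonneg _) (by positivity)
      _ = T₀ / c' * (Real.exp (-(κ * D (blk x) y')) * Real.exp (-(κ₁ * D y' y))) := by field_simp
      _ ≤ T₀ / c' * (Real.exp (-(κ₁ * D (blk x) y)) * Real.exp (-((κ - κ₁) * D (blk x) y'))) :=
          mul_le_mul_of_nonneg_left htri (by positivity)
      _ = _ := by ring
  calc ‖∑ y', (A⁻¹ * (Qm q)ᴴ) x y' * (sandwich A q)⁻¹ y' y‖
      ≤ ∑ y', ‖(A⁻¹ * (Qm q)ᴴ) x y' * (sandwich A q)⁻¹ y' y‖ := norm_sum_le _ _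
    _ ≤ ∑ y', T₀ / c' * Real.exp (-(κ₁ * D (blk x) y)) * Real.exp (-((κ - κ₁) * D (blk x) y')) :=
        Finset.sum_le_sum fun y' _ => hterm y'
    _ = T₀ / c' * Real.exp (-(κ₁ * D (blk x) y)) * ∑ y', Real.exp (-((κ - κ₁) * D (blk x) y')) := by
        rw [Finset.mul_sum]
    _ ≤ T₀ / c' * Real.exp (-(κ₁ * D (blk x) y)) * L :=
        mul_le_mul_of_nonneg_left (hL (blk x)) (by positivity)
    _ = T₀ * L / c' * Real.exp (-(κ₁ * D (blk x) y)) := by ring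

/-- **(46)-SHAPE, SUP SIDE, site-weight form: `‖(HB)(x)‖ ≤ C_H·L′·sup‖B‖`** with the row profile `Σ_y e^{−κ₁D(y₀,y)} ≤ L′` —
block-cardinality-free. [folklore] -/
theorem norm_minimiser_mulVec_le_site (A : Matrix X X ℂ) (blk : X → Y) (D : Y → Y → ℝ) (hD0 : ∀ y, D y y = 0)
    (hDtri : ∀ i j k, D i k ≤ D i j + D j k) (hDs : ∀ i j, D i j = D j i) (ρ : Y → X → ℝ) (δ : ℝ)
    (hρ0 : ∀ y' x, blk x = y' → ρ y' x ≤ δ) (hρD : ∀ y y' x, blk x = y → D y y' - δ ≤ ρ y' x)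
    (q : Y → X → ℂ) (hq : ∀ y x, blk x ≠ y → q y x = 0) {N : ℝ} (hN0 : 0 ≤ N) (hN : ∀ y, nsq (q y) ≤ N)
    {κ ν₀ : ℝ} {ν : Y → ℝ} (hκ : 0 ≤ κ) (hν0 : 0 < ν₀) (hfl : ∀ y, ν₀ ≤ ν y)
    (hc : ∀ y', ∀ z : X → ℂ, ∑ x, ν (blk x) * ‖z x‖ ^ 2 ≤ (conjForm A κ (ρ y') z).re)
    {cS : ℝ} (hcS : ∀ B : Y → ℂ, cS * nsq B ≤ (star B ⬝ᵥ (sandwich A q *ᵥ B)).re)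
    {κ₁ L₁ L L' : ℝ} (hκ₁ : 0 ≤ κ₁) (hL₁ : ∀ y, ∑ y', D y y' * Real.exp (-((κ - κ₁) * D y y')) ≤ L₁)
    (hsmall : κ₁ * (N / ν₀ * Real.exp (2 * κ * δ)) * L₁ < cS)
    (hL : ∀ y₀, ∑ y', Real.exp (-((κ - κ₁) * D y₀ y')) ≤ L)
    (hL' : ∀ y₀, ∑ y, Real.exp (-(κ₁ * D y₀ y)) ≤ L') (B : Y → ℂ) {β : ℝ} (hB : ∀ y, ‖B y‖ ≤ β) (x : X) :
    ‖(minimiser A (Qm q) *ᵥ B) x‖ ≤ Real.sqrt N / ν₀ * Real.exp (2 * κ * δ) * L /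
        (cS - κ₁ * (N / ν₀ * Real.exp (2 * κ * δ)) * L₁) * L' * β := by
  set C : ℝ := Real.sqrt N / ν₀ * Real.exp (2 * κ * δ) * L / (cS - κ₁ * (N / ν₀ * Real.exp (2 * κ * δ)) * L₁) with hC
  have hc'0 : 0 < cS - κ₁ * (N / ν₀ * Real.exp (2 * κ * δ)) * L₁ := by linarith
  have hL0 : 0 ≤ L := le_trans (Finset.sum_nonneg fun _ _ => (Real.exp_pos _).le) (hL (blk x))
  have hC0 : 0 ≤ C := by rw [hC]; positivity
  have hβ0 : 0 ≤ β := le_trans (norm_nonneg _) (hB (blk x))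
  have hH' := norm_minimiser_apply_le_site A blk D hD0 hDtri hDs ρ δ hρ0 hρD q hq hN0 hN hκ hν0 hfl hc hcS hκ₁ hL₁ hsmall hL x
  rw [Matrix.mulVec, dotProduct]
  calc ‖∑ y, minimiser A (Qm q) x y * B y‖ ≤ ∑ y, ‖minimiser A (Qm q) x y * B y‖ := norm_sum_le _ _
    _ ≤ ∑ y, C * Real.exp (-(κ₁ * D (blk x) y)) * β := Finset.sum_le_sum fun y _ => by
        rw [norm_mul]; exact mul_le_mul (hH' y) (hB y) (norm_nonneg _) (by positivity)
    _ = C * β * ∑ y, Real.exp (-(κ₁ * D (blk x) y)) := by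
        rw [Finset.mul_sum]; refine Finset.sum_congr rfl fun y _ => ?_; ring
    _ ≤ C * β * L' := mul_le_mul_of_nonneg_left (hL' (blk x)) (mul_nonneg hC0 hβ0)
    _ = C * L' * β := by ring

/-! ## §4 THE MODEL HALF-INSTANCE: `A = cmat levelOp` on a covering cube family (K4 §6's setting, verbatim) -/

section Model

open Summit.QuantumFields.BalabanUV.Beta.BoxPoincare (Box)
open Summit.QuantumFields.BalabanUV.Beta.MultiscaleCoerciveTorus Summit.QuantumFields.BalabanUV.Beta.MultiscaleDistance
open Summit.QuantumFields.BalabanUV.Beta.MultiscaleDecayBudget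
open Summit.QuantumFields.BalabanUV.Beta.MultiscaleDistanceMetric (sdist_comm sdist_triangle_torus)
open Summit.QuantumFields.BalabanUV.Beta.CovariantTowerMatrix (cmat)
open Literature.MathematicalPhysics.QuantumFieldTheory.Balaban1983to89
open Literature.MathematicalPhysics.QuantumFieldTheory.Balaban1983to89.B9Thm37GluePU (bsrc btgt)
open Literature.MathematicalPhysics.QuantumFieldTheory.Balaban1983to89.B9Thm37GlueTorusCov (tblk torusComb)
open Literature.MathematicalPhysics.QuantumFieldTheory.Balaban1983to89.B9Thm37GlueTorusCovLevels (levelOp)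
open B5TorusCover (UT Ctr ctrU)

variable {d : ℕ} {N : Fin d → ℕ} [∀ i, NeZero (N i)] [NeZero d] {Cp J K : Type} [Fintype Cp] [DecidableEq Cp] [Nonempty Cp]
  [Fintype J] [Fintype K] [DecidableEq K] (S : J → ℕ) (hS : ∀ l, 1 ≤ S l) (hdivS : ∀ l i, S l ∣ N i) (lvl : K → J)
  (zc : (k : K) → Ctr N (S (lvl k)))
  (hdisj : ∀ k k' v v', cellPt S hS hdivS lvl zc k v = cellPt S hS hdivS lvl zc k' v' → k = k')
  (hcover : ∀ x : UT N, ∃ k, ∃ v : Box d (S (lvl k)), cellPt S hS hdivS lvl zc k v = x)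
  (Rm : UT N × Fin d → Cp → Cp → ℝ) (hRm : ∀ b i j, ∑ k, Rm b k i * Rm b k j = if i = j then (1 : ℝ) else 0)
  (T : J → UT N → Cp → Cp → ℝ) (hT : ∀ l x i i', ∑ k, T l x k i * T l x k i' = if i = i' then (1 : ℝ) else 0)
  (a : J → ℝ) (ha : ∀ j, 0 ≤ a j) (ω : J → UT N → ℝ)
  (hsupp : ∀ l x, ω l (ctrU N (S l) (tblk (hS l) (hdivS l) x)) ≠ 0 → ∃ k v, lvl k = l ∧ cellPt S hS hdivS lvl zc k v = x)
  {amax : ℝ} (hamax : 0 ≤ amax)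
  (hscale : ∀ k, a (lvl k) * ω (lvl k) (ctrU N (S (lvl k)) (zc k)) ^ 2 * (S (lvl k) : ℝ) ^ d ≤ amax / (S (lvl k) : ℝ) ^ 2)
  (c : UT N × Fin d → ℝ) {cmax : ℝ} (hc : ∀ b, |c b| ≤ cmax) {C : ℝ}
  (hcoer : ∀ f : UT N × Cp → ℝ,
    C * ∑ k, ((S (lvl k) : ℝ) ^ 2)⁻¹ * ∑ v : Box d (S (lvl k)), ∑ i, f (cellPt S hS hdivS lvl zc k v, i) ^ 2 ≤
      ∑ p, f p * levelOp bsrc btgt c Rm (fun l x => ctrU N (S l) (tblk (hS l) (hdivS l) x))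
        (fun l x => ω l (ctrU N (S l) (tblk (hS l) (hdivS l) x))) T a f p)
  {κ : ℝ} (hκ0 : 0 ≤ κ) (hκ1 : κ ≤ 1)
  (hμ : 0 < C - 2 * d * cmax ^ 2 * κ ^ 2 - amax * (Real.exp (2 * d * κ) - 1))
  {Smax : ℕ} (hSmax1 : 1 ≤ Smax) (hSmax : ∀ l, S l ≤ Smax)
  (q : K → UT N × Cp → ℂ) (hq : ∀ k p, cellOf S hS hdivS lvl zc hcover p.1 ≠ k → q k p = 0) {Nq : ℝ} (hNq0 : 0 ≤ Nq)
  (hNq : ∀ k, nsq (q k) ≤ Nq) {cS : ℝ}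
  (hcS : ∀ B : K → ℂ, cS * nsq B ≤ (star B ⬝ᵥ (sandwich (cmat (levelOp bsrc btgt c Rm
    (fun l x => ctrU N (S l) (tblk (hS l) (hdivS l) x)) (fun l x => ω l (ctrU N (S l) (tblk (hS l) (hdivS l) x))) T a)) q *ᵥ B)).re)
  {κ₁ L₁ : ℝ} (hκ₁ : 0 ≤ κ₁)
  (hL₁ : ∀ k, ∑ k', sdist bsrc btgt (siteScale S hS hdivS lvl zc hcover) (ctrU N (S (lvl k)) (zc k)) (ctrU N (S (lvl k')) (zc k')) *
      Real.exp (-((κ - κ₁) * sdist bsrc btgt (siteScale S hS hdivS lvl zc hcover) (ctrU N (S (lvl k)) (zc k))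
        (ctrU N (S (lvl k')) (zc k')))) ≤ L₁)
  (hsmall : κ₁ * (Nq / ((C - 2 * d * cmax ^ 2 * κ ^ 2 - amax * (Real.exp (2 * d * κ) - 1)) * ((Smax : ℝ) ^ 2)⁻¹) *
      Real.exp (2 * κ * (2 * d))) * L₁ < cS)

/-- The floor bookkeeping: `0 < μ₀S_max⁻² ≤ μ₀S⁻²` for `1 ≤ S ≤ S_max`, `μ₀ > 0`. [folklore] -/
theorem floor_le {μ₀ : ℝ} (hμ : 0 < μ₀) {S₀ Smax : ℕ} (hS₀ : 1 ≤ S₀) (hSmax1 : 1 ≤ Smax) (hle : S₀ ≤ Smax) :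
    0 < μ₀ * ((Smax : ℝ) ^ 2)⁻¹ ∧ μ₀ * ((Smax : ℝ) ^ 2)⁻¹ ≤ μ₀ * ((S₀ : ℝ) ^ 2)⁻¹ := by
  have hSpos : (0 : ℝ) < S₀ := by exact_mod_cast hS₀
  have hSm : (0 : ℝ) < Smax := by exact_mod_cast hSmax1
  exact ⟨mul_pos hμ (inv_pos.mpr (pow_pos hSm 2)),
    mul_le_mul_of_nonneg_left (inv_anti₀ (pow_pos hSpos 2) (pow_le_pow_left₀ hSpos.le (by exact_mod_cast hle) 2)) hμ.le⟩

include hdisj hRm hT ha hsupp hamax hscale hc hcoer hκ0 hκ1 hμ hSmax1 hSmax hq hNq0 hNq hcS hκ₁ hL₁ hsmall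

/-- **THE SANDWICHED INVERSE OF THE MODEL OPERATOR HAS THE E6 ROW ON THE CELL LATTICE.**  K4 §6's setting (torus `UT N`; isometric
`Rm`, `T`; `a ≥ 0`; level weights supported on the cells of a pairwise-disjoint COVERING cube family, print-size from above; `|c| ≤ c_max`;
cell-sum coercivity `C`; `0 ≤ κ ≤ 1`, `μ₀ := C − 2d·c_max²κ² − a_max(e^{2dκ} − 1) > 0`; `S_l ≤ S_max`); cell tests `q_k` supported in
cell `k` with `‖q_k‖² ≤ Nq`; the sandwich `Re`-coercive with `c_S` (DISPLAYED — row D4's (I3)); first-moment profile `L₁` of `d_n` on the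
corners at rate `κ − κ₁`; `κ₁·θ·L₁ < c_S` with `θ = Nq∕(μ₀S_max⁻²)·e^{4κd}`.  THEN
`‖(Q(cmat levelOp)⁻¹Q*)⁻¹(k,k′)‖ ≤ e^{−κ₁·d_n(t_k,t_{k′})}∕(c_S − κ₁θL₁)` — §1 with `hc := localConjCoercive_cmat_levelOp`, thresholds
`:= sdist_corner_thresholds` (`δ = 2d`), pseudo-metric `:= sdist_self ∕ sdist_comm ∕ sdist_triangle_torus` BY NAME. [folklore] -/
theorem norm_cellSandwichInv_levelOp_le (k k' : K) :
    ‖(sandwich (cmat (levelOp bsrc btgt c Rm (fun l x => ctrU N (S l) (tblk (hS l) (hdivS l) x))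
        (fun l x => ω l (ctrU N (S l) (tblk (hS l) (hdivS l) x))) T a)) q)⁻¹ k k'‖ ≤
      Real.exp (-(κ₁ * sdist bsrc btgt (siteScale S hS hdivS lvl zc hcover) (ctrU N (S (lvl k)) (zc k))
        (ctrU N (S (lvl k')) (zc k')))) /
        (cS - κ₁ * (Nq / ((C - 2 * d * cmax ^ 2 * κ ^ 2 - amax * (Real.exp (2 * d * κ) - 1)) * ((Smax : ℝ) ^ 2)⁻¹) *
          Real.exp (2 * κ * (2 * d))) * L₁) := by
  classical
  have hthr := sdist_corner_thresholds S hS hdivS lvl zc hdisj hcover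
  have hfl := fun k : K => (floor_le hμ (hS (lvl k)) hSmax1 (hSmax (lvl k))).2
  have hν0 := (floor_le hμ (hS (lvl k)) hSmax1 (hSmax (lvl k))).1
  exact norm_sandwich_inv_apply_le_site (cmat _) (fun p : UT N × Cp => cellOf S hS hdivS lvl zc hcover p.1)
    (fun k k' => sdist bsrc btgt (siteScale S hS hdivS lvl zc hcover) (ctrU N (S (lvl k)) (zc k)) (ctrU N (S (lvl k')) (zc k')))
    (fun k => sdist_self bsrc btgt _ _) (fun i j k => sdist_triangle_torus _ _ _ _) (fun i j => sdist_comm bsrc btgt _ _ _)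
    (fun k' p => sdist bsrc btgt (siteScale S hS hdivS lvl zc hcover) p.1 (ctrU N (S (lvl k')) (zc k'))) (2 * d)
    (fun k' p hp => (hthr p.1 k').1 hp) (fun k k' p hp => by have h := (hthr p.1 k').2; rw [hp] at h; exact h) q hq hNq0 hNq
    hκ0 hν0 hfl
    (fun k' z => localConjCoercive_cmat_levelOp S hS hdivS lvl zc hdisj hcover Rm hRm T hT a ha ω hsupp hamax hscale c hc
      hcoer hκ0 hκ1 (ctrU N (S (lvl k')) (zc k')) z) hcS hκ₁ hL₁ hsmall k k'

/-- **THE MODEL MINIMISER `H = A⁻¹Q*(QA⁻¹Q*)⁻¹` HAS THE E6 ROW** (same setting + the zeroth-moment profile `L`): for every fine site∕component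
`p` and every cell `k`, `‖H(p,k)‖ ≤ (√Nq·e^{4κd}·L∕(μ₀S_max⁻²·(c_S − κ₁θL₁)))·e^{−κ₁·d_n(t_{cell p}, t_k)}` — constants from
`d, c_max, a_max, C, κ, κ₁, S_max, Nq, c_S, L₁, L` ONLY (§3 on §4's data).  In units `S_max = 1` the prefactor is level-free. [folklore] -/
theorem norm_minimiser_levelOp_apply_le {L : ℝ}
    (hL : ∀ k, ∑ k', Real.exp (-((κ - κ₁) * sdist bsrc btgt (siteScale S hS hdivS lvl zc hcover) (ctrU N (S (lvl k)) (zc k))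
      (ctrU N (S (lvl k')) (zc k')))) ≤ L) (p : UT N × Cp) (k : K) :
    ‖minimiser (cmat (levelOp bsrc btgt c Rm (fun l x => ctrU N (S l) (tblk (hS l) (hdivS l) x))
        (fun l x => ω l (ctrU N (S l) (tblk (hS l) (hdivS l) x))) T a)) (Qm q) p k‖ ≤
      Real.sqrt Nq / ((C - 2 * d * cmax ^ 2 * κ ^ 2 - amax * (Real.exp (2 * d * κ) - 1)) * ((Smax : ℝ) ^ 2)⁻¹) *
          Real.exp (2 * κ * (2 * d)) * L /
        (cS - κ₁ * (Nq / ((C - 2 * d * cmax ^ 2 * κ ^ 2 - amax * (Real.exp (2 * d * κ) - 1)) * ((Smax : ℝ) ^ 2)⁻¹) *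
          Real.exp (2 * κ * (2 * d))) * L₁) *
        Real.exp (-(κ₁ * sdist bsrc btgt (siteScale S hS hdivS lvl zc hcover)
          (ctrU N (S (lvl (cellOf S hS hdivS lvl zc hcover p.1))) (zc (cellOf S hS hdivS lvl zc hcover p.1)))
          (ctrU N (S (lvl k)) (zc k)))) := by
  classical
  have hthr := sdist_corner_thresholds S hS hdivS lvl zc hdisj hcover
  have hfl := fun k : K => (floor_le hμ (hS (lvl k)) hSmax1 (hSmax (lvl k))).2
  have hν0 := (floor_le hμ (hS (lvl k)) hSmax1 (hSmax (lvl k))).1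
  exact norm_minimiser_apply_le_site (cmat _) (fun p : UT N × Cp => cellOf S hS hdivS lvl zc hcover p.1)
    (fun k k' => sdist bsrc btgt (siteScale S hS hdivS lvl zc hcover) (ctrU N (S (lvl k)) (zc k)) (ctrU N (S (lvl k')) (zc k')))
    (fun k => sdist_self bsrc btgt _ _) (fun i j k => sdist_triangle_torus _ _ _ _) (fun i j => sdist_comm bsrc btgt _ _ _)
    (fun k' p => sdist bsrc btgt (siteScale S hS hdivS lvl zc hcover) p.1 (ctrU N (S (lvl k')) (zc k'))) (2 * d)
    (fun k' p hp => (hthr p.1 k').1 hp) (fun k k' p hp => by have h := (hthr p.1 k').2; rw [hp] at h; exact h) q hq hNq0 hNq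
    hκ0 hν0 hfl
    (fun k' z => localConjCoercive_cmat_levelOp S hS hdivS lvl zc hdisj hcover Rm hRm T hT a ha ω hsupp hamax hscale c hc
      hcoer hκ0 hκ1 (ctrU N (S (lvl k')) (zc k')) z) hcS hκ₁ hL₁ hsmall hL p k

end Model

/-! ## §5 Rule G-1 (the one-site toy inhabits §3) and the NEGATIVE two-site lemma behind F-ne7cleaf07g12-1 -/

/-- G-1 (degenerate-but-legal): one fine site, one block, `A = 1`, `q = r = 1`, `D = ρ = 0`, `δ = 0`, `κ = κ₁ = 0`, `N = ν = ν₀ = L = 1`,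
`L₁ = 0`, `c_S = 1∕1` (file 2's `sandwich_reCoercive_of_accretive` with `m_A = E = 1`) — every hypothesis of `norm_minimiser_apply_le_site`
is inhabited and the END fires. [folklore] -/
example (x y : Fin 1) :
    ‖minimiser (1 : Matrix (Fin 1) (Fin 1) ℂ) (Qm (fun (_ : Fin 1) (_ : Fin 1) => (1 : ℂ))) x y‖
      ≤ Real.sqrt 1 / 1 * Real.exp (2 * 0 * 0) * 1 / ((1 : ℝ) / 1 - 0 * (1 / 1 * Real.exp (2 * 0 * 0)) * 0)
          * Real.exp (-(0 * (fun _ _ => (0 : ℝ)) (id x) y)) := by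
  refine norm_minimiser_apply_le_site (1 : Matrix (Fin 1) (Fin 1) ℂ) id (fun _ _ => (0 : ℝ)) (fun _ => rfl)
    (fun _ _ _ => by norm_num) (fun _ _ => rfl) (fun _ _ => (0 : ℝ)) 0 (fun _ _ _ => le_rfl) (fun _ _ _ _ => by norm_num)
    (fun _ _ => (1 : ℂ)) (fun y x h => absurd (Subsingleton.elim _ _) h) zero_le_one (fun y' => by simp [nsq]) le_rfl
    one_pos (ν := fun _ => 1) (fun _ => le_rfl)
    (fun y' z => by rw [re_conjForm_one, nsq]; exact le_of_eq (Finset.sum_congr rfl fun e _ => by simp)) ?_ le_rfl ?_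
    (by norm_num) ?_ x y
  · exact sandwich_reCoercive_of_accretive (1 : Matrix (Fin 1) (Fin 1) ℂ) (mA := 1) one_pos
      (fun g => by rw [Matrix.one_mulVec, star_dotProduct_self, Complex.ofReal_re, one_mul])
      (fun _ _ => (1 : ℂ)) (fun _ _ => (1 : ℂ))
      (by ext i j; simp [Matrix.mul_apply, Qm, Matrix.one_apply, Subsingleton.elim i j]) (E := 1) one_pos
      (fun B => by
        rw [Matrix.conjTranspose_one, Matrix.one_mulVec, one_mul]
        unfold nsq superpose
        simp [Qm, Matrix.mulVec, dotProduct, Matrix.conjTranspose_apply])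
  · intro y₀; simp
  · intro y₀; simp

/-- **THE NEGATIVE TWO-SITE LEMMA (why files 1∕2's block-constant binder is not the MODEL's).**  One bond of weight `c` between two fine
sites lying in DIFFERENT blocks, plus a site gap `γ`: `A = [[c²+γ, −c²],[−c², c²+γ]]`; the block-constant weight `ρ = (0, D)`.  If `A` is
conjugated-coercive with constant `m` along `ρ` at rate `κ` (files 1∕2's `hc` at this granularity), then `m ≤ γ − c²·(cosh(κD) − 1)`
(test vector `z = (1,1)`): a positive `m` forces `κ·D < arcosh(1 + γ∕c²) ≤ √(2γ)∕c` — for the MODEL's local gap `γ ≍ μ₀n⁻²` the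
certified rate per unit of block distance decays like `n⁻¹ = L^{−j}`.  The site-weight form (§1–§4) spreads the same `D` over the `n`
bonds of a cell (`κ·n⁻¹` per bond, `MultiscaleDecayBudget.bond_budget_le`), level-free. [folklore] -/
theorem blockConstant_conjCoercive_le (c γ κ D m : ℝ)
    (hc : ∀ z : Fin 2 → ℂ, m * nsq z ≤
      (conjForm (!![((c ^ 2 + γ : ℝ) : ℂ), ((-c ^ 2 : ℝ) : ℂ); ((-c ^ 2 : ℝ) : ℂ), ((c ^ 2 + γ : ℝ) : ℂ)]) κ ![0, D] z).re) :
    m ≤ γ - c ^ 2 * (Real.cosh (κ * D) - 1) := by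
  have h := hc ![1, 1]
  have hn : nsq (![1, 1] : Fin 2 → ℂ) = 2 := by
    simp [nsq, Fin.sum_univ_two]; norm_num
  rw [hn] at h
  unfold conjForm at h
  simp only [Fin.sum_univ_two, Matrix.cons_val_zero, Matrix.cons_val_one, Matrix.of_apply, Matrix.cons_val',
    Matrix.empty_val', Matrix.cons_val_fin_one, map_one, one_mul, mul_one, sub_self, sub_zero, zero_sub, mul_zero,
    Real.exp_zero, Complex.ofReal_one, Complex.add_re, Complex.mul_re, Complex.ofReal_re, Complex.ofReal_im] at h
  rw [Real.cosh_eq]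
  have e1 : Real.exp (κ * -D) = Real.exp (-(κ * D)) := by ring_nf
  rw [e1] at h
  nlinarith [h, Real.exp_pos (κ * D), Real.exp_pos (-(κ * D))]

end Summit.QuantumFields.BalabanUV.T4Continuum.ShellMeasureMinimiserDecaySite

end
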